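import Literature.Computation.FiniteGraph.SAWLatticeDomains
import HarnessLib

/-!
# Finite-graph witness engine, XI: kernel-decidable path, disjointness, separation and
# INTERLACING checks for SAWs of lattice domains; site-list domains

Topic `Literature/Computation/FiniteGraph`; everything proved, no facts. The crux `BoundaryTP2`
(route `SAWTotalPositivity`) quantifies, besides the weight inequality certified by parts V–IX, over
GEOMETRIC side conditions on four lattice points of a domain: every SAW `p₁ → p₃` meets every SAW
`p₂ → p₄` (interlacing), and the pairings `(p₁p₂ | p₃p₄)`, `(p₁p₄ | p₂p₃)` are realised by
vertex-disjoint SAWs. For the graph `ℤ²` induced on a finite site list `S` (hypothesis `hG` of parts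
VI–VIII, discharged here for every CONNECTED site list) this file makes all of them ONE Boolean:

* `inducedZ2 S` — `ℤ²[S]` as a `SimpleGraph (Site 2)` (its `hG` is `Iff.rfl`);
* `chainOK`, `pathOK S a b l` with **`exists_isPath_of_pathOK`** / **`exists_domainSAW_of_pathOK`** —
  a listed site sequence is a self-avoiding lattice path `a → b` inside `S` (explicit SAWs as data:
  lower bounds, pairing witnesses); `disjointB` with **`exists_disjoint_domainSAW_of_check`**;
* `bfsStep`, `bfs`, `separatedB S' c d` with **`mem_bfs_of_walk`** / **`false_of_separatedB`** —
  breadth-first reachability in `ℤ²[S']` (polynomial, unlike path enumeration) and its soundness: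
  if the check passes, no walk of `ℤ²[S']` joins `c` to `d`;
* `meetsAllB S p₁ p₃ p₂ p₄` with **`exists_common_of_meetsAllB`** / **`domainSAW_meets_of_meetsAllB`**
  — INTERLACING: for every enumerated SAW support `s : p₁ → p₃` (part VI, complete), either `p₂ ∈ s`,
  or `p₄ ∈ s`, or `p₂, p₄` are separated in `ℤ²[S ∖ s]`; hence every SAW `p₁ → p₃` of the domain
  meets every walk `p₂ → p₄` (cost `#SAW(p₁→p₃) · O(|S|²·diam)`, never the product of two
  enumerations);
* `connectedB S`, **`latticeDomainOfList S h : LatticeDobrushin`** and `list_adj_iff` — every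
  connected site list is a lattice Dobrushin domain (`siteDomain {x | toPair x ∈ S}` at mesh `1`), so
  parts VII–VIII apply to it hypothesis-free: `SAW_weight_list_eq`,
  `list_weight_mul_weight_lt_of_posCert`;
* **`tp2ViolationCheck`** and **`exists_tp2Violation_of_check`** — the whole finitely-refutable
  content of a `BoundaryTP2` counterexample on a site-list domain (connectivity, interlacing, the
  two disjoint pairings as explicit paths, and part V's sign certificate for the REVERSED strict
  inequality `Z₁₂Z₃₄ < Z₁₃Z₂₄` on an interval `∋ x_c`) behind one `decide`; the only hypothesis
  left is `SimplyConnectedSpace (siteDomain _)`, discharged for boxes and unions of boxes in part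
  XII (`SAWDomainTopology.lean`). No such certificate is asserted here: the file is the checker.

[folklore] throughout (BFS/DFS; Madras–Slade 1993 §1.1 for SAWs; the domains are those of
Duminil-Copin–Hongler–Nolin 2011 §2.2 as rendered by the tree's `LatticeDobrushin`).

Measured on the Lean farm (corner quadruple of a box, `meetsAllB`): `3 × 3` (12 SAWs) instantaneous and
`4 × 4` (184 SAWs) ≈ 10 s under `decide +kernel`; `5 × 5` (8 512 SAWs) and `6 × 5` (79 384 SAWs)
together ≈ 14 s under `native_decide` — the same feasibility class as the weight polynomials of part VI,
whose enumeration the check repeats once.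

## References
* N. Madras, G. Slade, *The Self-Avoiding Walk*, Birkhäuser 1993, §1.1 [MadrasSlade1993].
* H. Duminil-Copin, C. Hongler, P. Nolin, CPAM 64 (2011), §2.2 [DuminilCopinHonglerNolin2011].
-/

namespace Literature.Computation.FiniteGraph

open Literature.Probability.LatticeModels Literature.Probability.RandomPlanarGeometry
open Literature.Probability.RandomPlanarGeometry.SAW.FiniteMemory (toPair toPair_injective)
open scoped ENNReal

/-! ### `ℤ²` induced on a site list, as a graph -/

/-- The graph `ℤ²[S]`: nearest-neighbour bonds of `ℤ²` with both endpoints in the site list `S`.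
[folklore] -/
def inducedZ2 (S : List (ℤ × ℤ)) : SimpleGraph (Site 2) where
  Adj x y := (zdGraph 2).Adj x y ∧ toPair x ∈ S ∧ toPair y ∈ S
  symm := ⟨fun _ _ h => ⟨h.1.symm, h.2.2, h.2.1⟩⟩
  loopless := ⟨fun _ h => h.1.ne rfl⟩

/-- The hypothesis `hG` of parts VI–VIII holds for `inducedZ2 S` by definition. [folklore] -/
theorem inducedZ2_adj (S : List (ℤ × ℤ)) (x y : Site 2) :
    (inducedZ2 S).Adj x y ↔ (zdGraph 2).Adj x y ∧ toPair x ∈ S ∧ toPair y ∈ S := Iff.rfl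

/-! ### Explicit paths as checked data -/

/-- Consecutive entries are lattice neighbours and all entries lie in `S`. [folklore] -/
def chainOK (S : List (ℤ × ℤ)) : List (ℤ × ℤ) → Bool
  | [] => true
  | [u] => decide (u ∈ S)
  | u :: w :: l => decide (u ∈ S) && decide (w ∈ nbrs u) && chainOK S (w :: l)

/-- `l` lists, in order, the sites of a self-avoiding lattice path from `a` to `b` inside `S`.
[folklore] -/
def pathOK (S : List (ℤ × ℤ)) (a b : ℤ × ℤ) (l : List (ℤ × ℤ)) : Bool :=
  decide (l.head? = some a) && decide (l.getLast? = some b) && decide l.Nodup && chainOK S l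

/-- The first entry of an accepted chain lies in `S`. [folklore] -/
theorem mem_of_chainOK {S : List (ℤ × ℤ)} {u : ℤ × ℤ} : ∀ {l : List (ℤ × ℤ)}, chainOK S (u :: l) = true → u ∈ S
  | [], h => by simpa [chainOK] using h
  | w :: l, h => by
      simp only [chainOK, Bool.and_eq_true, decide_eq_true_eq] at h
      exact h.1.1

section Graph

variable {S : List (ℤ × ℤ)} {G : SimpleGraph (Site 2)}
  (hG : ∀ x y : Site 2, G.Adj x y ↔ (zdGraph 2).Adj x y ∧ toPair x ∈ S ∧ toPair y ∈ S)
include hG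

/-- An accepted chain is the support of a walk of `G`. [folklore] -/
theorem exists_walk_of_chainOK : ∀ (l : List (ℤ × ℤ)) (u b : ℤ × ℤ), chainOK S (u :: l) = true →
    (u :: l).getLast? = some b → ∃ p : G.Walk (ofPair u) (ofPair b), p.support.map toPair = u :: l
  | [], u, b, _, hb => by
      have hub : u = b := by simpa using hb
      subst hub
      exact ⟨SimpleGraph.Walk.nil, by simp⟩
  | w :: l, u, b, h, hb => by
      have hwS : w ∈ S := by
        simp only [chainOK, Bool.and_eq_true, decide_eq_true_eq] at h
        exact mem_of_chainOK h.2
      simp only [chainOK, Bool.and_eq_true, decide_eq_true_eq] at h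
      obtain ⟨⟨huS, hwn⟩, hrest⟩ := h
      rw [List.getLast?_cons_cons] at hb
      obtain ⟨q, hq⟩ := exists_walk_of_chainOK l w b hrest hb
      have hadj : G.Adj (ofPair u) (ofPair w) :=
        (hG _ _).2 ⟨(zdGraph_adj_iff_mem_nbrs _ _).2 (by simpa using hwn), by simpa using huS, by simpa using hwS⟩
      exact ⟨SimpleGraph.Walk.cons hadj q, by simp [hq]⟩

/-- **Soundness of `pathOK`**: an accepted list is the support of a self-avoiding path `a → b` of
`G`. [folklore] -/
theorem exists_isPath_of_pathOK {a b : ℤ × ℤ} {l : List (ℤ × ℤ)} (h : pathOK S a b l = true) :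
    ∃ p : G.Walk (ofPair a) (ofPair b), p.IsPath ∧ p.support.map toPair = l := by
  simp only [pathOK, Bool.and_eq_true, decide_eq_true_eq] at h
  obtain ⟨⟨⟨ha, hb⟩, hnd⟩, hc⟩ := h
  cases l with
  | nil => simp at ha
  | cons u l =>
      have hua : u = a := by simpa using ha
      subst hua
      obtain ⟨p, hp⟩ := exists_walk_of_chainOK hG l u b hc hb
      refine ⟨p, SimpleGraph.Walk.IsPath.mk' ?_, hp⟩
      have : (p.support.map toPair).Nodup := by rw [hp]; exact hnd
      exact this.of_map

end Graph

/-! ### Breadth-first reachability and separation in `ℤ²[S']` -/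

/-- One round: add the sites of `S'` adjacent to the reached list `R`. [folklore] -/
def bfsStep (S' R : List (ℤ × ℤ)) : List (ℤ × ℤ) :=
  R ++ S'.filter fun w => !decide (w ∈ R) && R.any fun u => decide (w ∈ nbrs u)

/-- `k` rounds of breadth-first search from `R` inside `S'`. [folklore] -/
def bfs (S' : List (ℤ × ℤ)) : ℕ → List (ℤ × ℤ) → List (ℤ × ℤ)
  | 0, R => R
  | k + 1, R => bfs S' k (bfsStep S' R)

/-- [folklore] -/
theorem subset_bfsStep (S' R : List (ℤ × ℤ)) : R ⊆ bfsStep S' R := List.subset_append_left _ _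

/-- [folklore] -/
theorem subset_bfs (S' : List (ℤ × ℤ)) : ∀ (k : ℕ) (R : List (ℤ × ℤ)), R ⊆ bfs S' k R
  | 0, _ => fun _ h => h
  | k + 1, R => fun _ h => subset_bfs S' k _ (subset_bfsStep S' R h)

/-- The new sites of one round lie in `S'`; hence `bfs` stays inside `R ∪ S'`. [folklore] -/
theorem bfsStep_subset {S' R : List (ℤ × ℤ)} (hR : R ⊆ S') : bfsStep S' R ⊆ S' := by
  intro w hw
  rcases List.mem_append.1 hw with h | h
  · exact hR h
  · exact (List.mem_filter.1 h).1

/-- A lattice neighbour in `S'` of a reached site is reached after one round. [folklore] -/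
theorem mem_bfsStep_of_mem_nbrs {S' R : List (ℤ × ℤ)} {u w : ℤ × ℤ} (hu : u ∈ R) (hw : w ∈ S') (hn : w ∈ nbrs u) :
    w ∈ bfsStep S' R := by
  by_cases h : w ∈ R
  · exact subset_bfsStep S' R h
  · refine List.mem_append_right _ (List.mem_filter.2 ⟨hw, ?_⟩)
    simp only [h, decide_false, Bool.not_false, Bool.true_and, List.any_eq_true, decide_eq_true_eq]
    exact ⟨u, hu, hn⟩

/-- The separation test: `d` is not reached from `c` inside `S'` (`|S'|` rounds suffice). [folklore] -/
def separatedB (S' : List (ℤ × ℤ)) (c d : ℤ × ℤ) : Bool := !decide (d ∈ bfs S' S'.length [c])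

section BFS

variable {S' : List (ℤ × ℤ)} {G' : SimpleGraph (Site 2)}
  (hG' : ∀ x y : Site 2, G'.Adj x y ↔ (zdGraph 2).Adj x y ∧ toPair x ∈ S' ∧ toPair y ∈ S')
include hG'

/-- **Soundness of the search**: the endpoint of a walk of `ℤ²[S']` with at most `k` steps from a
site of `R` is reached after `k` rounds. [folklore] -/
theorem mem_bfs_of_walk : ∀ (k : ℕ) (R : List (ℤ × ℤ)) {x y : Site 2} (p : G'.Walk x y),
    p.length ≤ k → toPair x ∈ R → toPair y ∈ bfs S' k R
  | 0, R, x, y, p, hp, hx => by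
      have h0 : p.length = 0 := Nat.le_zero.1 hp
      have hxy := SimpleGraph.Walk.eq_of_length_eq_zero h0
      subst hxy
      exact hx
  | k + 1, R, x, y, p, hp, hx => by
      cases p with
      | nil => exact subset_bfs S' k _ (subset_bfsStep S' R hx)
      | @cons _ x₁ _ h q =>
          obtain ⟨hzd, -, hx₁⟩ := (hG' _ _).1 h
          have h₁ : toPair x₁ ∈ bfsStep S' R :=
            mem_bfsStep_of_mem_nbrs hx hx₁ ((zdGraph_adj_iff_mem_nbrs _ _).1 hzd)
          have hq : q.length ≤ k := by
            rw [SimpleGraph.Walk.length_cons] at hp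
            omega
          exact mem_bfs_of_walk k (bfsStep S' R) q hq h₁

/-- **Soundness of the separation test**: no walk of `ℤ²[S']` joins `c` to `d`. [folklore] -/
theorem false_of_separatedB {c d : ℤ × ℤ} (h : separatedB S' c d = true) {x y : Site 2} (hx : toPair x = c)
    (hy : toPair y = d) (p : G'.Walk x y) : False := by
  classical
  have hb := mem_bfs_of_walk hG' S'.length [c] p.bypass (length_le_of_isPath hG' p.bypass p.bypass_isPath)
    (by simp [hx])
  rw [hy] at hb
  simp only [separatedB, Bool.not_eq_true', decide_eq_false_iff_not] at h
  exact h hb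

end BFS

/-! ### Interlacing -/

/-- The sites of `S` not in `s`. [folklore] -/
def removeAll (S s : List (ℤ × ℤ)) : List (ℤ × ℤ) := S.filter fun x => !decide (x ∈ s)

/-- [folklore] -/
theorem mem_removeAll {S s : List (ℤ × ℤ)} {x : ℤ × ℤ} : x ∈ removeAll S s ↔ x ∈ S ∧ x ∉ s := by
  simp [removeAll, List.mem_filter]

/-- **The interlacing check** for `(p₁ → p₃)` against `(p₂ → p₄)` in `ℤ²[S]`: for every enumerated
SAW support `s : p₁ → p₃` (part VI, fuel `|S|`), `p₂ ∈ s` or `p₄ ∈ s` or `p₂, p₄` are separated in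
`ℤ²[S ∖ s]`. [folklore] -/
def meetsAllB (S : List (ℤ × ℤ)) (p₁ p₃ p₂ p₄ : ℤ × ℤ) : Bool :=
  (sawSupports S p₃ S.length p₁ []).all fun s =>
    decide (p₂ ∈ s) || decide (p₄ ∈ s) || separatedB (removeAll S s) p₂ p₄

section Interlacing

variable {S : List (ℤ × ℤ)} {G : SimpleGraph (Site 2)}
  (hG : ∀ x y : Site 2, G.Adj x y ↔ (zdGraph 2).Adj x y ∧ toPair x ∈ S ∧ toPair y ∈ S)
include hG

/-- A walk of `G` avoiding the vertices of a list `V` is a walk of `ℤ²[S ∖ V]`. [folklore] -/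
theorem nonempty_walk_inducedZ2_removeAll (V : List (Site 2)) :
    ∀ {x y : Site 2} (q : G.Walk x y), (∀ v ∈ q.support, v ∉ V) →
      Nonempty ((inducedZ2 (removeAll S (V.map toPair))).Walk x y) := by
  intro x y q
  induction q with
  | nil => intro; exact ⟨SimpleGraph.Walk.nil⟩
  | @cons a c _ h q ih =>
      intro hq
      have ha : a ∉ V := hq a (by simp)
      have hc : c ∉ V := hq c (by simp [q.start_mem_support])
      obtain ⟨hzd, haS, hcS⟩ := (hG _ _).1 h
      have hmem : ∀ {v : Site 2}, v ∉ V → toPair v ∉ V.map toPair := by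
        intro v hv hv'
        rw [List.mem_map] at hv'
        obtain ⟨v', hv', heq⟩ := hv'
        exact hv (toPair_injective heq ▸ hv')
      have hadj : (inducedZ2 (removeAll S (V.map toPair))).Adj a c :=
        ⟨hzd, mem_removeAll.2 ⟨haS, hmem ha⟩, mem_removeAll.2 ⟨hcS, hmem hc⟩⟩
      obtain ⟨q'⟩ := ih fun v hv => hq v (by simp [hv])
      exact ⟨SimpleGraph.Walk.cons hadj q'⟩

/-- **Soundness of the interlacing check.** If `meetsAllB S p₁ p₃ p₂ p₄` accepts then every
self-avoiding path `p₁ → p₃` of `G` and every walk `p₂ → p₄` of `G` have a common vertex.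
[folklore] -/
theorem exists_common_of_meetsAllB {p₁ p₃ p₂ p₄ : Site 2}
    (h : meetsAllB S (toPair p₁) (toPair p₃) (toPair p₂) (toPair p₄) = true)
    (P : G.Walk p₁ p₃) (hP : P.IsPath) (Q : G.Walk p₂ p₄) : ∃ v, v ∈ P.support ∧ v ∈ Q.support := by
  classical
  have hs := map_support_mem_sawSupports hG p₃ S.length P [] hP (length_le_of_isPath hG P hP) (by simp)
  simp only [meetsAllB, List.all_eq_true, Bool.or_eq_true, decide_eq_true_eq] at h
  rcases h _ hs with (h2 | h4) | hsep
  · rw [List.mem_map] at h2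
    obtain ⟨v, hv, hv'⟩ := h2
    have : v = p₂ := toPair_injective hv'
    subst this
    exact ⟨v, hv, Q.start_mem_support⟩
  · rw [List.mem_map] at h4
    obtain ⟨v, hv, hv'⟩ := h4
    have : v = p₄ := toPair_injective hv'
    subst this
    exact ⟨v, hv, Q.end_mem_support⟩
  · by_contra hne
    obtain ⟨q'⟩ := nonempty_walk_inducedZ2_removeAll hG P.support Q fun v hv hvP => hne ⟨v, hvP, hv⟩
    exact false_of_separatedB (inducedZ2_adj _) hsep rfl rfl q'

end Interlacing

/-! ### Disjoint pairings and the `DomainSAW` forms -/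

/-- No entry of `l₁` occurs in `l₂`. [folklore] -/
def disjointB (l₁ l₂ : List (ℤ × ℤ)) : Bool := l₁.all fun x => !decide (x ∈ l₂)

section Domain

variable {Ω : Set ℂ} {δ : ℝ} {S : List (ℤ × ℤ)}
  (hG : ∀ x y : Site 2, (discreteDomainGraph Ω δ).Adj x y ↔ (zdGraph 2).Adj x y ∧ toPair x ∈ S ∧ toPair y ∈ S)
include hG

/-- **A checked site list is a SAW of the domain.** [folklore] -/
theorem exists_domainSAW_of_pathOK {a b : Site 2} {l : List (ℤ × ℤ)} (h : pathOK S (toPair a) (toPair b) l = true) :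
    ∃ γ : SAW.DomainSAW Ω δ a b, γ.walk.support.map toPair = l := by
  obtain ⟨p, hp, hl⟩ := exists_isPath_of_pathOK hG h
  refine ⟨⟨p.copy (ofPair_toPair a) (ofPair_toPair b), ?_⟩, ?_⟩
  · simpa using hp
  · simpa using hl

/-- **Two checked, entrywise disjoint site lists are vertex-disjoint SAWs of the domain** (the
pairing hypotheses of `BoundaryTP2`). [folklore] -/
theorem exists_disjoint_domainSAW_of_check {a b c d : Site 2} {l₁ l₂ : List (ℤ × ℤ)}
    (h₁ : pathOK S (toPair a) (toPair b) l₁ = true) (h₂ : pathOK S (toPair c) (toPair d) l₂ = true)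
    (hd : disjointB l₁ l₂ = true) :
    ∃ (P : SAW.DomainSAW Ω δ a b) (Q : SAW.DomainSAW Ω δ c d), List.Disjoint P.walk.support Q.walk.support := by
  obtain ⟨P, hP⟩ := exists_domainSAW_of_pathOK hG h₁
  obtain ⟨Q, hQ⟩ := exists_domainSAW_of_pathOK hG h₂
  refine ⟨P, Q, fun x hxP hxQ => ?_⟩
  have hx₁ : toPair x ∈ l₁ := hP ▸ List.mem_map_of_mem hxP
  have hx₂ : toPair x ∈ l₂ := hQ ▸ List.mem_map_of_mem hxQ
  simp only [disjointB, List.all_eq_true, Bool.not_eq_true', decide_eq_false_iff_not] at hd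
  exact hd _ hx₁ hx₂

/-- **Interlacing in the domain**: every SAW `p₁ → p₃` meets every SAW `p₂ → p₄` (the interlacing
hypothesis of `BoundaryTP2`, for these four points). [folklore] -/
theorem domainSAW_meets_of_meetsAllB {p₁ p₃ p₂ p₄ : Site 2}
    (h : meetsAllB S (toPair p₁) (toPair p₃) (toPair p₂) (toPair p₄) = true)
    (P : SAW.DomainSAW Ω δ p₁ p₃) (Q : SAW.DomainSAW Ω δ p₂ p₄) :
    ∃ v, v ∈ P.walk.support ∧ v ∈ Q.walk.support :=
  exists_common_of_meetsAllB hG h P.walk P.isPath Q.walk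

end Domain

/-! ### Connected site lists are lattice Dobrushin domains -/

/-- Connectivity of `ℤ²[S]` by breadth-first search from the first site. [folklore] -/
def connectedB (S : List (ℤ × ℤ)) : Bool :=
  S.all fun y => decide (y ∈ bfs S S.length (S.take 1))

/-- Reached sites are joined to the start by lattice steps inside `S'`. [folklore] -/
theorem exists_reflTransGen_of_mem_bfs (S' : List (ℤ × ℤ)) : ∀ (k : ℕ) (R : List (ℤ × ℤ)), R ⊆ S' →
    ∀ y ∈ bfs S' k R, ∃ x ∈ R, Relation.ReflTransGen (SiteStep {z : Site 2 | toPair z ∈ S'}) (ofPair x) (ofPair y)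
  | 0, R, _, y, hy => ⟨y, hy, Relation.ReflTransGen.refl⟩
  | k + 1, R, hR, y, hy => by
      obtain ⟨x', hx', hpath⟩ := exists_reflTransGen_of_mem_bfs S' k (bfsStep S' R) (bfsStep_subset hR) y hy
      rcases List.mem_append.1 hx' with hxR | hxnew
      · exact ⟨x', hxR, hpath⟩
      · obtain ⟨hxS, hx2⟩ := List.mem_filter.1 hxnew
        simp only [Bool.and_eq_true, Bool.not_eq_true', decide_eq_false_iff_not, List.any_eq_true,
          decide_eq_true_eq] at hx2
        obtain ⟨-, u, hu, hn⟩ := hx2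
        refine ⟨u, hu, Relation.ReflTransGen.head ⟨?_, by simpa using hR hu, by simpa using hxS⟩ hpath⟩
        exact (zdGraph_adj_iff_mem_nbrs _ _).2 (by simpa using hn)

/-- **The lattice Dobrushin domain of a connected site list** (no wired arc): sites
`{x | toPair x ∈ S}`, realised as `siteDomain _` at mesh `1`. [cite: DuminilCopinHonglerNolin2011, §2.2] -/
def latticeDomainOfList (S : List (ℤ × ℤ)) (h : connectedB S = true) : LatticeDobrushin where
  S := {x | toPair x ∈ S}
  A := ∅
  finite := (List.finite_toSet S).preimage toPair_injective.injOn
  conn := by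
    intro x hx y hy
    simp only [Set.mem_setOf_eq] at hx hy
    simp only [connectedB, List.all_eq_true, decide_eq_true_eq] at h
    have hsub : S.take 1 ⊆ S := List.take_subset 1 S
    obtain ⟨x₁, hx₁, hpx⟩ := exists_reflTransGen_of_mem_bfs S S.length (S.take 1) hsub (toPair x) (h _ hx)
    obtain ⟨y₁, hy₁, hpy⟩ := exists_reflTransGen_of_mem_bfs S S.length (S.take 1) hsub (toPair y) (h _ hy)
    have heq : x₁ = y₁ := by
      cases S with
      | nil => simp at hx
      | cons r t =>
          simp only [List.take_succ_cons, List.take_zero, List.mem_singleton] at hx₁ hy₁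
          rw [hx₁, hy₁]
    subst heq
    rw [ofPair_toPair] at hpx hpy
    exact (reflTransGen_siteStep_reverse hpx).trans hpy
  A_subset := Set.empty_subset _

/-- The `hG` of parts VI–VIII for a connected site list, hypothesis-free. [folklore] -/
theorem list_adj_iff (S : List (ℤ × ℤ)) (h : connectedB S = true) (x y : Site 2) :
    (discreteDomainGraph (siteDomain {z : Site 2 | toPair z ∈ S}) 1).Adj x y ↔
      (zdGraph 2).Adj x y ∧ toPair x ∈ S ∧ toPair y ∈ S :=
  adj_iff_of_latticeDobrushin (latticeDomainOfList S h) (fun _ => Iff.rfl) x y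

/-- The site-list domain is bounded. [folklore] -/
theorem isBounded_siteDomain_list (S : List (ℤ × ℤ)) : Bornology.IsBounded (siteDomain {z : Site 2 | toPair z ∈ S}) :=
  isBounded_siteDomain ((List.finite_toSet S).preimage toPair_injective.injOn)

/-- **Critical two-point SAW weight of a connected site-list domain** (part VII, hypothesis-free).
[cite: LawlerSchrammWerner2004SAW, §3.1 and §3.4.2] -/
theorem SAW_weight_list_eq (S : List (ℤ × ℤ)) (h : connectedB S = true) (p q : Site 2) :
    SAW.weight (siteDomain {z : Site 2 | toPair z ∈ S}) 1 p q Set.univ =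
      ENNReal.ofReal (peval (sawPoly S p q) SAW.criticalFugacity) :=
  SAW_weight_univ_eq (list_adj_iff S h) p q

/-- Part VII's product certificate on a connected site-list domain, any interval `[lo, hi] ∋ x_c`.
[folklore] -/
theorem list_weight_mul_weight_lt_of_posCert (S : List (ℤ × ℤ)) (h : connectedB S = true)
    (a₁ b₁ a₂ b₂ a₃ b₃ a₄ b₄ : Site 2) {lo hi : ℚ} {d : ℕ}
    (hlo : (lo : ℝ) ≤ SAW.criticalFugacity) (hhi : SAW.criticalFugacity ≤ hi)
    (hc : posCert (psub (pmul (sawPoly S a₃ b₃) (sawPoly S a₄ b₄)) (pmul (sawPoly S a₁ b₁) (sawPoly S a₂ b₂))) d lo hi = true) :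
    SAW.weight (siteDomain {z : Site 2 | toPair z ∈ S}) 1 a₁ b₁ Set.univ *
        SAW.weight (siteDomain {z : Site 2 | toPair z ∈ S}) 1 a₂ b₂ Set.univ <
      SAW.weight (siteDomain {z : Site 2 | toPair z ∈ S}) 1 a₃ b₃ Set.univ *
        SAW.weight (siteDomain {z : Site 2 | toPair z ∈ S}) 1 a₄ b₄ Set.univ :=
  weight_mul_weight_lt_of_posCert (list_adj_iff S h) a₁ b₁ a₂ b₂ a₃ b₃ a₄ b₄ hlo hhi hc

/-! ### The `BoundaryTP2`-violation certificate on a site-list domain -/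

/-- **All finite checks of a TP₂-violation certificate** on the domain of the site list `S` with
marked points `p₁, p₂, p₃, p₄`: `S` connected; `(p₁ → p₃)` interlaced with `(p₂ → p₄)`; explicit
disjoint SAW pairs `l₁₂ : p₁ → p₂`, `l₃₄ : p₃ → p₄` and `l₁₄ : p₁ → p₄`, `l₂₃ : p₂ → p₃`; and part
V's sign certificate (depth `d`, interval `[lo, hi]`) for the REVERSED strict inequality
`Z₁₂ Z₃₄ < Z₁₃ Z₂₄` of length polynomials. [folklore] -/
def tp2ViolationCheck (S : List (ℤ × ℤ)) (p₁ p₂ p₃ p₄ : ℤ × ℤ) (l₁₂ l₃₄ l₁₄ l₂₃ : List (ℤ × ℤ))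
    (d : ℕ) (lo hi : ℚ) : Bool :=
  connectedB S && meetsAllB S p₁ p₃ p₂ p₄ &&
    pathOK S p₁ p₂ l₁₂ && pathOK S p₃ p₄ l₃₄ && disjointB l₁₂ l₃₄ &&
    pathOK S p₁ p₄ l₁₄ && pathOK S p₂ p₃ l₂₃ && disjointB l₁₄ l₂₃ &&
    posCert (psub (pmul (ofNatList (sawCounts S p₁ p₃)) (ofNatList (sawCounts S p₂ p₄)))
      (pmul (ofNatList (sawCounts S p₁ p₂)) (ofNatList (sawCounts S p₃ p₄)))) d lo hi

/-- **Soundness: a TP₂ violation in the shape of `¬ BoundaryTP2`.** If the check accepts for the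
pairs of four lattice points, the site-list domain is simply connected, and `x_c ∈ [lo, hi]`, then
with `Ω = siteDomain {z | toPair z ∈ S}`, `δ = 1`: `Ω` is bounded and simply connected, `0 < δ`, every
SAW `p₁ → p₃` meets every SAW `p₂ → p₄`, both pairings are realised by vertex-disjoint SAWs, and
`Z(p₁,p₂) Z(p₃,p₄) < Z(p₁,p₃) Z(p₂,p₄)` — so `Z₁₃Z₂₄ ≤ Z₁₂Z₃₄` FAILS there. [folklore] -/
theorem exists_tp2Violation_of_check (S : List (ℤ × ℤ)) (p₁ p₂ p₃ p₄ : Site 2)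
    (l₁₂ l₃₄ l₁₄ l₂₃ : List (ℤ × ℤ)) {d : ℕ} {lo hi : ℚ}
    (hsc : SimplyConnectedSpace (siteDomain {z : Site 2 | toPair z ∈ S}))
    (hlo : (lo : ℝ) ≤ SAW.criticalFugacity) (hhi : SAW.criticalFugacity ≤ hi)
    (h : tp2ViolationCheck S (toPair p₁) (toPair p₂) (toPair p₃) (toPair p₄) l₁₂ l₃₄ l₁₄ l₂₃ d lo hi = true) :
    ∃ (Ω : Set ℂ) (δ : ℝ), Bornology.IsBounded Ω ∧ SimplyConnectedSpace Ω ∧ 0 < δ ∧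
      (∀ (P : SAW.DomainSAW Ω δ p₁ p₃) (Q : SAW.DomainSAW Ω δ p₂ p₄), ∃ v, v ∈ P.walk.support ∧ v ∈ Q.walk.support) ∧
      (∃ (P : SAW.DomainSAW Ω δ p₁ p₂) (Q : SAW.DomainSAW Ω δ p₃ p₄), List.Disjoint P.walk.support Q.walk.support) ∧
      (∃ (P : SAW.DomainSAW Ω δ p₁ p₄) (Q : SAW.DomainSAW Ω δ p₂ p₃), List.Disjoint P.walk.support Q.walk.support) ∧
      SAW.weight Ω δ p₁ p₂ Set.univ * SAW.weight Ω δ p₃ p₄ Set.univ <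
        SAW.weight Ω δ p₁ p₃ Set.univ * SAW.weight Ω δ p₂ p₄ Set.univ := by
  simp only [tp2ViolationCheck, Bool.and_eq_true] at h
  obtain ⟨⟨⟨⟨⟨⟨⟨⟨hconn, hmeet⟩, h12⟩, h34⟩, hd1⟩, h14⟩, h23⟩, hd2⟩, hcert⟩ := h
  have hG := list_adj_iff S hconn
  refine ⟨siteDomain {z : Site 2 | toPair z ∈ S}, 1, isBounded_siteDomain_list S, hsc, one_pos,
    fun P Q => domainSAW_meets_of_meetsAllB hG hmeet P Q, ?_, ?_, ?_⟩
  · exact exists_disjoint_domainSAW_of_check hG h12 h34 hd1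
  · exact exists_disjoint_domainSAW_of_check hG h14 h23 hd2
  · exact weight_mul_weight_lt_of_posCert hG p₁ p₂ p₃ p₄ p₁ p₃ p₂ p₄ hlo hhi hcert

/-- **The same as the refutation of the universally quantified TP₂ statement** (literally the shape
of `¬ BoundaryTP2`), given the certificate and simple connectivity of the domain. [folklore] -/
theorem not_tp2_forall_of_check (S : List (ℤ × ℤ)) (p₁ p₂ p₃ p₄ : Site 2)
    (l₁₂ l₃₄ l₁₄ l₂₃ : List (ℤ × ℤ)) {d : ℕ} {lo hi : ℚ}
    (hsc : SimplyConnectedSpace (siteDomain {z : Site 2 | toPair z ∈ S}))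
    (hlo : (lo : ℝ) ≤ SAW.criticalFugacity) (hhi : SAW.criticalFugacity ≤ hi)
    (h : tp2ViolationCheck S (toPair p₁) (toPair p₂) (toPair p₃) (toPair p₄) l₁₂ l₃₄ l₁₄ l₂₃ d lo hi = true) :
    ¬ (∀ (Ω : Set ℂ) (δ : ℝ) (p₁ p₂ p₃ p₄ : Site 2), Bornology.IsBounded Ω → SimplyConnectedSpace Ω → 0 < δ →
      (∀ (P : SAW.DomainSAW Ω δ p₁ p₃) (Q : SAW.DomainSAW Ω δ p₂ p₄), ∃ v, v ∈ P.walk.support ∧ v ∈ Q.walk.support) →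
      (∃ (P : SAW.DomainSAW Ω δ p₁ p₂) (Q : SAW.DomainSAW Ω δ p₃ p₄), List.Disjoint P.walk.support Q.walk.support) →
      (∃ (P : SAW.DomainSAW Ω δ p₁ p₄) (Q : SAW.DomainSAW Ω δ p₂ p₃), List.Disjoint P.walk.support Q.walk.support) →
      SAW.weight Ω δ p₁ p₃ Set.univ * SAW.weight Ω δ p₂ p₄ Set.univ ≤
        SAW.weight Ω δ p₁ p₂ Set.univ * SAW.weight Ω δ p₃ p₄ Set.univ) := by
  intro hall
  obtain ⟨Ω, δ, hb, hsc', hδ, hint, hpair₁, hpair₂, hlt⟩ :=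
    exists_tp2Violation_of_check S p₁ p₂ p₃ p₄ l₁₂ l₃₄ l₁₄ l₂₃ hsc hlo hhi h
  exact absurd (hall Ω δ p₁ p₂ p₃ p₄ hb hsc' hδ hint hpair₁ hpair₂) (not_le.2 hlt)

/-! ### Kernel regression examples (the `3 × 3` box as a site list) -/

/-- Corner points of the `3 × 3` box in cyclic order are interlaced: every SAW `(0,0) → (2,2)` meets
every SAW `(2,0) → (0,2)` (12 SAW supports, one BFS each). -/
example : meetsAllB (boxList (0, 0) (2, 2)) (0, 0) (2, 2) (2, 0) (0, 2) = true := by decide +kernel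

/-- … whereas `(0,0) → (2,0)` and `(2,2) → (0,2)` are realised disjointly by the bottom and top rows. -/
example : (pathOK (boxList (0, 0) (2, 2)) (0, 0) (2, 0) [(0, 0), (1, 0), (2, 0)] &&
    pathOK (boxList (0, 0) (2, 2)) (2, 2) (0, 2) [(2, 2), (1, 2), (0, 2)] &&
    disjointB [(0, 0), (1, 0), (2, 0)] [(2, 2), (1, 2), (0, 2)]) = true := by decide +kernel

/-- The `3 × 3` box is connected, and TP₂ HOLDS at its corners (part VIII's example), so the
violation certificate is rejected. -/
example : connectedB (boxList (0, 0) (2, 2)) = true ∧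
    tp2ViolationCheck (boxList (0, 0) (2, 2)) (0, 0) (2, 0) (2, 2) (0, 2)
      [(0, 0), (1, 0), (2, 0)] [(2, 2), (1, 2), (0, 2)] [(0, 0), (0, 1), (0, 2)] [(2, 0), (2, 1), (2, 2)] 0 (1 / 3) (1 / 2) = false := by
  decide +kernel

end Literature.Computation.FiniteGraph
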